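import Literature.MathematicalPhysics.QuantumFieldTheory.ConformalBootstrap3D.SingleCorrelatorCertificate
import Literature.MathematicalPhysics.QuantumFieldTheory.ConformalBootstrap3D.CasimirRecursionPivots
import Mathlib.Topology.Algebra.Order.LiminfLimsup
import Mathlib.Topology.Order.OrderClosed
import HarnessLib

/-!
# Block positivity at a non-regular point from a right neighbourhood (closed cells at the unitarity bound)

A certificate cell for spin `ℓ ≥ 2` is `[ℓ+1, t₁]`, closed at the unitarity bound `Δ = ℓ+1`, where the
predicate `IsConformalBlock3D` is the limit clause (the block is the pointwise limit on the square of
the blocks `g_{Δ',ℓ}`, `Δ' ↓ Δ`; `SigmaEpsilonSystem.lean`) and where the evaluator's positivity input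
`hrCoeff_nonneg` needs `unitarityBound3D ℓ < Δ` strictly (`ZSeriesBlockCoefficients.lean`). For a
point-evaluation functional `φ = ∑_k w_k ev_{(z_k, z̄_k)}` the value `φ[F^{σσ,σσ}_{-,Δ,ℓ}[g]]` is a finite
combination of values of `g` at nodes of the open square and their reflections `(1-z_k, 1-z̄_k)`, so it is
the limit of `φ[F[g_{Δ',ℓ}]]` and positivity passes to the limit (`ge_of_tendsto`). Hence a cell enclosure
need only be valid on the HALF-OPEN cell: `blockPositive_of_eventually_right` — if `Δ` is not regular and,
for `Δ'` in a right neighbourhood, `(Δ', ℓ)` is regular and `BlockPositive φ s Δ' ℓ`, then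
`BlockPositive φ s Δ ℓ`. (`cellPositive_of_eventually_right` is the cell form.) The "eventually regular"
hypothesis is discharged separately for the unitarity bound by finiteness of the degeneracy set per spin
with an EXPLICIT margin: `not_accidentalDegeneracy3D_of_lt_bound_add` — no degeneracy in `(ℓ+1, ℓ+1+1/(2ℓ))`
(from `accidentalDegeneracy3D_unreachable` and an integrality argument), hence
`eventually_isRegularPoint3D_nhdsGT_bound` and the ready-made cell form `cellPositive_of_Ioc_bound`.
Elementary real analysis (limits of finite sums). [folklore]
-/

namespace Literature.MathematicalPhysics.QuantumFieldTheory.ConformalBootstrap3D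

open Set Filter Topology

/-- The reflected node `(1 - z, 1 - z̄)` of a node in the open square lies in the open square. [folklore] -/
theorem one_sub_mem_Ioo {z : ℝ} (hz : z ∈ Ioo (0 : ℝ) 1) : 1 - z ∈ Ioo (0 : ℝ) 1 :=
  ⟨by linarith [hz.2], by linarith [hz.1]⟩

/-- For a family `G Δ'` converging pointwise on the open square to `g`, the values of the
point-evaluation functional on `crossF s sign (G Δ')` converge to its value on `crossF s sign g`
(nodes in the open square). [folklore] -/
theorem tendsto_pointFunctional_crossF {n : ℕ} (w z zb : Fin n → ℝ)
    (hz : ∀ k, z k ∈ Ioo (0 : ℝ) 1) (hzb : ∀ k, zb k ∈ Ioo (0 : ℝ) 1) (s sign : ℝ)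
    (G : ℝ → ℝ → ℝ → ℝ) (g : ℝ → ℝ → ℝ) (l : Filter ℝ)
    (hG : ∀ x y : ℝ, x ∈ Ioo (0 : ℝ) 1 → y ∈ Ioo (0 : ℝ) 1 →
      Tendsto (fun Δ' => G Δ' x y) l (𝓝 (g x y))) :
    Tendsto (fun Δ' => pointFunctional w z zb (crossF s sign (G Δ')))
      l (𝓝 (pointFunctional w z zb (crossF s sign g))) := by
  simp only [pointFunctional_apply, crossF]
  refine tendsto_finsetSum _ fun k _ => ?_
  refine Tendsto.const_mul _ ?_
  refine Tendsto.add ?_ ?_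
  · exact Tendsto.const_mul _ (hG _ _ (hz k) (hzb k))
  · exact Tendsto.const_mul _ (hG _ _ (one_sub_mem_Ioo (hz k)) (one_sub_mem_Ioo (hzb k)))

/-- **Positivity at a non-regular point from the right.** If `(Δ, ℓ)` is not regular (unitarity bound
or accidental degeneracy) and for all `Δ'` in some right neighbourhood of `Δ` the point `(Δ', ℓ)` is
regular and `φ` is block-positive at `(Δ', ℓ)`, then `φ` is block-positive at `(Δ, ℓ)` — for a
point-evaluation functional with nodes in the open square. Uses only the limit clause of
`IsConformalBlock3D` and `ge_of_tendsto`. [folklore] -/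
theorem blockPositive_of_eventually_right {n : ℕ} (w z zb : Fin n → ℝ)
    (hz : ∀ k, z k ∈ Ioo (0 : ℝ) 1) (hzb : ∀ k, zb k ∈ Ioo (0 : ℝ) 1) (s Δ : ℝ) (ℓ : ℕ)
    (hΔ : ¬ IsRegularPoint3D Δ ℓ)
    (h : ∀ᶠ Δ' in 𝓝[>] Δ, IsRegularPoint3D Δ' ℓ ∧ BlockPositive (pointFunctional w z zb) s Δ' ℓ) :
    BlockPositive (pointFunctional w z zb) s Δ ℓ := by
  intro g hg
  rcases hg with ⟨hreg, _⟩ | ⟨_, G, hGabove, hGlim⟩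
  · exact absurd hreg hΔ
  have hlim := tendsto_pointFunctional_crossF w z zb hz hzb s (-1) G g (𝓝[>] Δ) hGlim
  refine ge_of_tendsto hlim ?_
  have hIoo : Ioo Δ (Δ + 1) ∈ 𝓝[>] Δ := Ioo_mem_nhdsGT (by linarith)
  filter_upwards [h, hIoo] with Δ' hΔ' hmem
  exact hΔ'.2 (G Δ') (Or.inl ⟨hΔ'.1, hGabove Δ' hmem⟩)

/-- **Cell form.** A cell `[a, b]` whose left endpoint `a` is a non-regular point for spin `ℓ` is
positive on `Q` as soon as it is positive on the half-open cell `(a, b]` and the points just to the right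
of `a` are regular. [folklore] -/
theorem cellPositive_of_eventually_right {n : ℕ} (w z zb : Fin n → ℝ)
    (hz : ∀ k, z k ∈ Ioo (0 : ℝ) 1) (hzb : ∀ k, zb k ∈ Ioo (0 : ℝ) 1) (Q : Set (ℝ × ℝ)) (ℓ : ℕ)
    {a b : ℝ} (hab : a < b) (hA : ¬ IsRegularPoint3D a ℓ)
    (hreg : ∀ᶠ Δ' in 𝓝[>] a, IsRegularPoint3D Δ' ℓ)
    (hopen : ∀ p ∈ Q, ∀ Δ ∈ Ioc a b, BlockPositive (pointFunctional w z zb) p.1 Δ ℓ) :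
    CellPositive (pointFunctional w z zb) Q ℓ a b := by
  intro p hp Δ hΔ
  rcases eq_or_lt_of_le hΔ.1 with hΔa | hΔa
  · rw [← hΔa]
    refine blockPositive_of_eventually_right w z zb hz hzb p.1 a ℓ hA ?_
    have hIoc : Ioc a b ∈ 𝓝[>] a := Ioc_mem_nhdsGT hab
    filter_upwards [hreg, hIoc] with Δ' h1 h2
    exact ⟨h1, hopen p hp Δ' h2⟩
  · exact hopen p hp Δ ⟨hΔa, hΔ.2⟩

/-! ### Points just above the unitarity bound are regular (explicit margin `1/(2ℓ)`) -/

/-- **Explicit regularity margin above the unitarity bound.** For `ℓ ≥ 1` and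
`ℓ + 1 < Δ < ℓ + 1 + 1/(2ℓ)` there is no accidental degeneracy: a degeneracy above the bound has an
unreachable witness `(n, j)` with `1 ≤ n`, `n + j < ℓ` (`accidentalDegeneracy3D_unreachable`), and its
pivot equation reads `2n(Δ - (ℓ+1)) = -P₀` with the INTEGER `P₀ = n(n-3) + j(j+1) - ℓ(ℓ+1) + 2n(ℓ+1)`;
the left side is positive, so `-P₀ ≥ 1` and `Δ - (ℓ+1) ≥ 1/(2n) > 1/(2ℓ)`. [folklore] -/
theorem not_accidentalDegeneracy3D_of_lt_bound_add {Δ : ℝ} {ℓ : ℕ} (hℓ : 1 ≤ ℓ)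
    (hlo : (ℓ : ℝ) + 1 < Δ) (hhi : Δ < (ℓ : ℝ) + 1 + 1 / (2 * (ℓ : ℝ))) :
    ¬ accidentalDegeneracy3D Δ ℓ := by
  intro h
  have hb : unitarityBound3D ℓ < Δ := by
    unfold unitarityBound3D
    rw [if_neg (by omega)]
    exact hlo
  obtain ⟨n, j, hn, hnj, _, hz⟩ := accidentalDegeneracy3D_unreachable hb h
  unfold casimirPivot3D at hz
  -- the integer `P₀`
  set P : ℤ := (n : ℤ) * ((n : ℤ) - 3) + (j : ℤ) * ((j : ℤ) + 1) - (ℓ : ℤ) * ((ℓ : ℤ) + 1)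
    + 2 * (n : ℤ) * ((ℓ : ℤ) + 1) with hP
  have hPreal : (P : ℝ) = (n : ℝ) * ((n : ℝ) - 3) + (j : ℝ) * ((j : ℝ) + 1)
      - (ℓ : ℝ) * ((ℓ : ℝ) + 1) + 2 * (n : ℝ) * ((ℓ : ℝ) + 1) := by
    rw [hP]; push_cast; ring
  have hnpos : (0 : ℝ) < (n : ℝ) := by exact_mod_cast hn
  have hkey : 2 * (n : ℝ) * (Δ - ((ℓ : ℝ) + 1)) = -(P : ℝ) := by
    rw [hPreal]; linarith
  have hpos : (0 : ℝ) < -(P : ℝ) := by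
    rw [← hkey]
    have : (0 : ℝ) < Δ - ((ℓ : ℝ) + 1) := by linarith
    positivity
  have hPle : P ≤ -1 := by
    have : (P : ℝ) < 0 := by linarith
    have hP0 : P < 0 := by exact_mod_cast this
    omega
  have hPle' : (1 : ℝ) ≤ -(P : ℝ) := by
    have : ((P : ℤ) : ℝ) ≤ ((-1 : ℤ) : ℝ) := by exact_mod_cast hPle
    push_cast at this
    linarith
  -- `Δ - (ℓ+1) ≥ 1/(2n) > 1/(2ℓ)`
  have hnl : (n : ℝ) < (ℓ : ℝ) := by exact_mod_cast (show n < ℓ by omega)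
  have hlpos : (0 : ℝ) < (ℓ : ℝ) := by exact_mod_cast hℓ
  have h1 : 1 / (2 * (ℓ : ℝ)) < 1 / (2 * (n : ℝ)) := by
    apply one_div_lt_one_div_of_lt
    · positivity
    · linarith
  have h2 : 1 / (2 * (n : ℝ)) ≤ Δ - ((ℓ : ℝ) + 1) := by
    rw [div_le_iff₀ (by positivity)]
    linarith [hkey, hPle']
  linarith

/-- For `ℓ ≥ 1`, every `Δ ∈ (ℓ+1, ℓ+1+1/(2ℓ))` is a regular point. [folklore] -/
theorem isRegularPoint3D_of_lt_bound_add {Δ : ℝ} {ℓ : ℕ} (hℓ : 1 ≤ ℓ)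
    (hlo : (ℓ : ℝ) + 1 < Δ) (hhi : Δ < (ℓ : ℝ) + 1 + 1 / (2 * (ℓ : ℝ))) :
    IsRegularPoint3D Δ ℓ := by
  refine ⟨?_, not_accidentalDegeneracy3D_of_lt_bound_add hℓ hlo hhi⟩
  unfold unitarityBound3D
  rw [if_neg (by omega)]
  exact ne_of_gt hlo

/-- The points just to the right of the unitarity bound `ℓ + 1` (`ℓ ≥ 1`) are eventually regular —
the hypothesis `hreg` of `cellPositive_of_eventually_right` for a cell starting at the bound. [folklore] -/
theorem eventually_isRegularPoint3D_nhdsGT_bound {ℓ : ℕ} (hℓ : 1 ≤ ℓ) :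
    ∀ᶠ Δ' in 𝓝[>] ((ℓ : ℝ) + 1), IsRegularPoint3D Δ' ℓ := by
  have hlpos : (0 : ℝ) < (ℓ : ℝ) := by exact_mod_cast hℓ
  have hδ : (0 : ℝ) < 1 / (2 * (ℓ : ℝ)) := by positivity
  have hIoo : Ioo ((ℓ : ℝ) + 1) ((ℓ : ℝ) + 1 + 1 / (2 * (ℓ : ℝ))) ∈ 𝓝[>] ((ℓ : ℝ) + 1) :=
    Ioo_mem_nhdsGT (by linarith)
  filter_upwards [hIoo] with Δ' hΔ'
  exact isRegularPoint3D_of_lt_bound_add hℓ hΔ'.1 hΔ'.2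

/-- **The unitarity-bound endpoint of a spinning cell comes for free.** For `ℓ ≥ 1` and a cell
`[ℓ+1, b]`: positivity on the half-open cell `(ℓ+1, b]` (where `hrCoeff_nonneg` applies) gives
`CellPositive` on the closed cell, for point-evaluation functionals with nodes in the open square.
This is the form a certificate row uses at `t_{ℓ,0} = ℓ + 1`. [folklore] -/
theorem cellPositive_of_Ioc_bound {n : ℕ} (w z zb : Fin n → ℝ)
    (hz : ∀ k, z k ∈ Ioo (0 : ℝ) 1) (hzb : ∀ k, zb k ∈ Ioo (0 : ℝ) 1) (Q : Set (ℝ × ℝ)) {ℓ : ℕ}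
    (hℓ : 1 ≤ ℓ) {b : ℝ} (hb : (ℓ : ℝ) + 1 < b)
    (hopen : ∀ p ∈ Q, ∀ Δ ∈ Ioc ((ℓ : ℝ) + 1) b, BlockPositive (pointFunctional w z zb) p.1 Δ ℓ) :
    CellPositive (pointFunctional w z zb) Q ℓ ((ℓ : ℝ) + 1) b := by
  refine cellPositive_of_eventually_right w z zb hz hzb Q ℓ hb ?_
    (eventually_isRegularPoint3D_nhdsGT_bound hℓ) hopen
  intro hreg
  apply hreg.1
  unfold unitarityBound3D
  rw [if_neg (by omega)]

end Literature.MathematicalPhysics.QuantumFieldTheory.ConformalBootstrap3D
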